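import Summits.CriticalPhenomena.PercolationContinuityZ3.Theorems.Transplant.FKConnectivityAllQAntipodalMinorWeightUpc
import HarnessLib

/-!
# Connectivity correlation inequalities for `φ_{w,q}`, every `q > 0` — file 23f: the FAVOURABLY POLARIZED Theorem U (`PU¹`):
# the antipodal up-correlation functional with one free edge pinned to the UP-SET replica

Support file (`--supports stmt-CriticalPhenomena-4575`), FK sub-lane `prim-bschramm-fk-2` (gen 24); builds on p205010 (kernel theorem,
internal audit signed; external expert review pending).  No definitions, no named facts, no sorries; standard axioms.

THE OBJECT.  `…AntipodalMinorWeightUpc.lean` proved THEOREM U in every cell and at every cluster level: for a two-terminal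
series–parallel network `E` between `s, t`, a free set `M ⊆ E`, a contracted set `C ⊆ E`, every weight `w ≥ 0` of the antipodal
exponent `k(γ∪C) + k((M\γ)∪C)` and every test function `h` monotone on the subsets of `M`,
`0 ≤ apUpcCLW w M C s t h = ∑_{γ ⊆ M} w(·) (1{s↔t in γ∪C} − 1{s↔t in (M\γ)∪C}) h(γ)`.
This file PINS one free edge `e ∈ M` to the FIRST member of the complementary pair: restricting the sum to `γ ∋ e` (so that `e` is open
in the replica `γ ∪ C` read by `h` and closed in the antipodal replica `(M \ γ) ∪ C`) keeps the functional nonnegative, provided `h`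
is monotone AND NONNEGATIVE (`FK.apUpcCLW_polarized_nonneg_of_isTTSP`).  The proof is one line of bookkeeping: the pinned sum is
`apUpcCLW` against the test function `h′(γ) = 1{e ∈ γ} · h(γ \ e)`, which is monotone exactly because `h ≥ 0`
(`FK.polarizedTest_mono`) — conditioning an up-set on containing `e` is again an up-set.  The OPPOSITE polarization (`γ ∌ e`, i.e.
`e` pinned to the replica NOT favoured by `h`) conditions on a down-closed event and is false in general (fk-2 gen 23 census: it fails in
about a third of the cells of the two-terminal series–parallel networks with ≤ 7 edges, memo FROM-fk-2-g23-THETA §5.5), which is why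
only this half is stated.  Level forms: `FK.apUpcC_polarized_level_nonneg_of_isTTSP` (every exact level) and
`FK.apUpcC_polarized_levels_le_nonneg_of_isTTSP` (Abel partial sums).
USE.  In the three-box normal form of the level-3 antipodal inequality (`maj₃`, FK-Q2 §32–§33) a box `B` with special edge `r` sees the
rest of the host as its root edge `e = ab` in one of four states (contracted / deleted / open in the up-set replica only / open in the
other replica only); the first three states are signed by Theorem U in the cells `e ∈ C`, `e ∉ M ∪ C` and by the present file, the
fourth is the located obstruction (memo FROM-fk-2-g24-BLACKBOX.md).
[cite: Grimmett2006, §1.4 eq. (1.20) (p. 15); §3.8 Thm. (3.90) (pp. 61–62)] [cite: Wagner2006, Thm. 5.8(d), §5.3]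
-/

noncomputable section

namespace Summit.CriticalPhenomena.PercolationContinuityZ3.Theorems

namespace FK

open SimpleGraph Literature.Probability.LatticeModels Literature.Probability.Percolation
open scoped Classical

variable {V : Type*} [Fintype V]

section Polarized

variable {s t : V}

omit [Fintype V] in
/-- **The polarized test function is monotone.**  If `h` is monotone and nonnegative on the subsets of `M`, then so is
`γ ↦ 1{e ∈ γ} · h(γ \ e)` (conditioning an up-set on containing a fixed edge is an up-set). [folklore] -/
theorem polarizedTest_mono {M : Finset (Sym2 V)} (e : Sym2 V) {h : Finset (Sym2 V) → ℝ}
    (hnonneg : ∀ ⦃A : Finset (Sym2 V)⦄, A ⊆ M → 0 ≤ h A)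
    (hmono : ∀ ⦃A B : Finset (Sym2 V)⦄, A ⊆ B → B ⊆ M → h A ≤ h B) :
    ∀ ⦃A B : Finset (Sym2 V)⦄, A ⊆ B → B ⊆ M →
      (if e ∈ A then h (A.erase e) else 0) ≤ (if e ∈ B then h (B.erase e) else 0) := by
  intro A B hAB hBM
  by_cases hA : e ∈ A
  · have hB : e ∈ B := hAB hA
    rw [if_pos hA, if_pos hB]
    exact hmono (Finset.erase_subset_erase e hAB) ((Finset.erase_subset e B).trans hBM)
  · rw [if_neg hA]
    by_cases hB : e ∈ B
    · rw [if_pos hB]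
      exact hnonneg ((Finset.erase_subset e B).trans hBM)
    · rw [if_neg hB]

/-- **THEOREM (favourably polarized Theorem U, `PU¹`; every weight, every cell).**  For a two-terminal series–parallel network `E`
between `s, t`, a free set `M ⊆ E`, a contracted set `C ⊆ E`, an edge `e`, every weight `w ≥ 0` and every test function `h` that is
monotone and nonnegative on the subsets of `M`:
`0 ≤ ∑_{γ ⊆ M, e ∈ γ} w(k(γ∪C)+k((M\γ)∪C)) · (1{s↔t in γ∪C} − 1{s↔t in (M\γ)∪C}) · h(γ \ e)` —
Theorem U survives pinning the free edge `e` to the replica favoured by `h` (for `e ∉ M` the sum is empty).  Proof: `apUpcCLW` against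
the monotone test function `1{e ∈ γ} h(γ \ e)`. [cite: Grimmett2006, §3.8 Thm. (3.90) (pp. 61–62)] [cite: Wagner2006, Thm. 5.8(d), §5.3] -/
theorem apUpcCLW_polarized_nonneg_of_isTTSP {E : Finset (Sym2 V)} (hE : IsTTSP E s t) {M C : Finset (Sym2 V)} (hM : M ⊆ E)
    (hC : C ⊆ E) (e : Sym2 V) {w : ℕ → ℝ} (hw : ∀ n, 0 ≤ w n) {h : Finset (Sym2 V) → ℝ}
    (hnonneg : ∀ ⦃A : Finset (Sym2 V)⦄, A ⊆ M → 0 ≤ h A)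
    (hmono : ∀ ⦃A B : Finset (Sym2 V)⦄, A ⊆ B → B ⊆ M → h A ≤ h B) :
    0 ≤ ∑ γ ∈ M.powerset with e ∈ γ,
      w (apExpC M C γ) * ((apConn (γ ∪ C) s t - apConn (M \ γ ∪ C) s t) * h (γ.erase e)) := by
  have key := apUpcCLW_nonneg_of_isTTSP hE M C hM hC w hw (fun γ => if e ∈ γ then h (γ.erase e) else 0)
    (polarizedTest_mono e hnonneg hmono)
  unfold apUpcCLW at key
  rw [Finset.sum_filter]
  refine key.trans_eq (Finset.sum_congr rfl fun γ _ => ?_)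
  by_cases h1 : e ∈ γ <;> simp [h1]

/-- **COROLLARY (`PU¹` at every exact cluster level).**  With `w = 1_{· = ℓ}`:
`0 ≤ ∑_{γ ⊆ M, e ∈ γ, k(γ∪C)+k((M\γ)∪C) = ℓ} (1{s↔t in γ∪C} − 1{s↔t in (M\γ)∪C}) h(γ \ e)`.
[cite: Grimmett2006, §3.8 Thm. (3.90) (pp. 61–62)] -/
theorem apUpcC_polarized_level_nonneg_of_isTTSP {E : Finset (Sym2 V)} (hE : IsTTSP E s t) {M C : Finset (Sym2 V)} (hM : M ⊆ E)
    (hC : C ⊆ E) (e : Sym2 V) (ℓ : ℕ) {h : Finset (Sym2 V) → ℝ} (hnonneg : ∀ ⦃A : Finset (Sym2 V)⦄, A ⊆ M → 0 ≤ h A)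
    (hmono : ∀ ⦃A B : Finset (Sym2 V)⦄, A ⊆ B → B ⊆ M → h A ≤ h B) :
    0 ≤ ∑ γ ∈ M.powerset with e ∈ γ ∧ apExpC M C γ = ℓ,
      (apConn (γ ∪ C) s t - apConn (M \ γ ∪ C) s t) * h (γ.erase e) := by
  have key := apUpcCLW_polarized_nonneg_of_isTTSP hE hM hC e (w := fun n => if n = ℓ then 1 else 0)
    (fun n => by split_ifs <;> norm_num) hnonneg hmono
  rw [Finset.sum_filter] at key ⊢
  refine key.trans_eq (Finset.sum_congr rfl fun γ _ => ?_)
  by_cases h1 : e ∈ γ <;> by_cases h2 : apExpC M C γ = ℓ <;> simp [h1, h2]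

/-- **COROLLARY (`PU¹`, Abel partial sums).**  With `w = 1_{· ≤ J}`:
`0 ≤ ∑_{γ ⊆ M, e ∈ γ, k(γ∪C)+k((M\γ)∪C) ≤ J} (1{s↔t in γ∪C} − 1{s↔t in (M\γ)∪C}) h(γ \ e)`.
[cite: Grimmett2006, §3.8 Thm. (3.90) (pp. 61–62)] -/
theorem apUpcC_polarized_levels_le_nonneg_of_isTTSP {E : Finset (Sym2 V)} (hE : IsTTSP E s t) {M C : Finset (Sym2 V)}
    (hM : M ⊆ E) (hC : C ⊆ E) (e : Sym2 V) (J : ℕ) {h : Finset (Sym2 V) → ℝ}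
    (hnonneg : ∀ ⦃A : Finset (Sym2 V)⦄, A ⊆ M → 0 ≤ h A)
    (hmono : ∀ ⦃A B : Finset (Sym2 V)⦄, A ⊆ B → B ⊆ M → h A ≤ h B) :
    0 ≤ ∑ γ ∈ M.powerset with e ∈ γ ∧ apExpC M C γ ≤ J,
      (apConn (γ ∪ C) s t - apConn (M \ γ ∪ C) s t) * h (γ.erase e) := by
  have key := apUpcCLW_polarized_nonneg_of_isTTSP hE hM hC e (w := fun n => if n ≤ J then 1 else 0)
    (fun n => by split_ifs <;> norm_num) hnonneg hmono
  rw [Finset.sum_filter] at key ⊢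
  refine key.trans_eq (Finset.sum_congr rfl fun γ _ => ?_)
  by_cases h1 : e ∈ γ <;> by_cases h2 : apExpC M C γ ≤ J <;> simp [h1, h2]

end Polarized

end FK

end Summit.CriticalPhenomena.PercolationContinuityZ3.Theorems

end
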